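import Literature.Barriers.ValiantsHypothesis.MonotoneGapParseTrees
import Literature.Barriers.ValiantsHypothesis.MonotoneGapPermanentWeights
import Literature.Computability.AlgebraicComplexity.PermanentIrreducible
import Mathlib.Data.Fintype.Perm
import Mathlib.Algebra.Group.End
import HarnessLib

/-!
# Jerrum–Snir's lower bound for the monotone complexity of the permanent (J. ACM 29 (1982), §4.3)

The combinatorial half of §4.3 of

* [JerrumSnir1982] M. Jerrum, M. Snir, *Some exact complexity results for straight-line
  computations over semirings*, J. ACM 29 (1982) 874–897.

For the generic permanent `perPoly (Fin n) R = per (X_{ij}) = Σ_σ Π_i X_{σ i, i}`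
(`Literature.Computability.AlgebraicComplexity.perPoly`, Mathlib's column-major convention):

* the monomial set of the permanent, on top of `permMonomial σ = Σ_i e_{(σ i, i)}`,
  `perPoly_eq_sum_monomial`, `coeff_permMonomial_perPoly`, `colCount_permMonomial` of
  `Literature/Computability/AlgebraicComplexity/PermanentIrreducible.lean` (reused, not restated):
  `mem_support_perPoly`, `support_perPoly`, `card_support_perPoly` (`|mon(per_n)| = n!`), and the
  shape of these monomials (degree `n`, multilinear, nonzero);
* `JerrumSnir.card_le_factorial_of_add_mem` — the partition argument of JS p. 887–888 for one
  set: if `a + e ∈ mon(per)` for all `a ∈ A` then all `a ∈ A` occupy the same `deg a₀` columns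
  (and rows), on which they are perfect matchings, so `|A| ≤ (deg a₀)!`, and
  `deg a₀ + deg e = n`.
* `JerrumSnir.card_mul_card_mul_card_le` — **the content bound for the permanent** in the
  three-set form: if `A + B + C ⊆ mon(per_n)` with `A, B, C ≠ ∅` then for `a ∈ A`, `b ∈ B`,
  `|A| · |B| · |C| ≤ (deg a)! (deg b)! (n - deg a - deg b)!` ("the total number of such
  permutations is clearly `d! (r-d)! (n-r)!`, and so we may take as our content bound
  `δ(r, d) = d! (r-d)! (n-r)!`").
* `JerrumSnir.contentBound_perPoly`, `JerrumSnir.weightBound_per` — the two hypotheses of the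
  general lower bound `JerrumSnir.sum_weight_le_prodCount` (`MonotoneGapParseTrees.lean`,
  JS Cor. 3.5) for the permanent, from `card_mul_card_mul_card_le` and from the arithmetic of
  `MonotoneGapPermanentWeights.lean` (condition (3.5), Lemma 3.6);
* `JerrumSnir.le_prodCount_perPoly` — **JS §4.3, the lower bound**: every monotone computation of
  `per_n` over `ℝ≥0` (`IsMonotoneComputation`, `MonotoneGap.lean`) has at least
  `n! · w(n) = n (2^{n-1} - 1)` product gates ("`⊗`-complexity of `p ≥ n!/(n-1)! · (2^{n-1} - 1)
  = n(2^{n-1} - 1)`"). The matching upper bound (Laplace expansion) and the assembly of the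
  named fact `JerrumSnir1982_permanent` are in `MonotoneGapPermanentUpper.lean` /
  `MonotoneGapProofs.lean`.
-/

noncomputable section

namespace Literature.Barriers.ValiantsHypothesis

namespace JerrumSnir

open Literature.Computability.AlgebraicComplexity MvPolynomial Finset Equiv

variable {n : ℕ}

/-! ### The monomials of the permanent -/

/-- All exponents of a permanent monomial are `≤ 1` (the permanent is multilinear).
[cite: JerrumSnir1982, §4.3] -/
theorem permMonomial_apply_le_one (σ : Perm (Fin n)) (k : Fin n × Fin n) :
    permMonomial σ k ≤ 1 := by
  obtain ⟨a, i⟩ := k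
  rw [permMonomial_apply]
  split_ifs <;> simp

/-- The degree of an exponent vector on `Fin n × Fin n` is the sum of its column counts.
[folklore] -/
theorem degree_eq_sum_colCount (x : Fin n × Fin n →₀ ℕ) : x.degree = ∑ i, colCount x i := by
  unfold colCount
  rw [Finsupp.degree_eq_sum, Fintype.sum_prod_type, Finset.sum_comm]

/-- Permanent monomials have degree `n`. [cite: JerrumSnir1982, §4.3] -/
theorem degree_permMonomial (σ : Perm (Fin n)) : (permMonomial σ).degree = n := by
  rw [degree_eq_sum_colCount]
  simp_rw [colCount_permMonomial]
  simp

/-- Permanent monomials are not the unit monomial when `n ≥ 1`. [folklore] -/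
theorem permMonomial_ne_zero (hn : 1 ≤ n) (σ : Perm (Fin n)) : permMonomial σ ≠ 0 := by
  intro h
  have := degree_permMonomial σ
  rw [h, map_zero] at this
  omega

/-- **The monomial set of the permanent**: `m ∈ mon(per_n) ↔ m = permMonomial σ` for some
permutation `σ` ("monomials of `per_{n×n}(X)` correspond to ... perfect matchings in `B_n`").
[cite: JerrumSnir1982, §4.3 (p. 887)] -/
theorem mem_support_perPoly (R : Type*) [CommSemiring R] [Nontrivial R]
    {m : Fin n × Fin n →₀ ℕ} :
    m ∈ (perPoly (Fin n) R).support ↔ ∃ σ : Perm (Fin n), permMonomial σ = m := by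
  constructor
  · intro h
    exact exists_permMonomial_eq_of_coeff_perPoly_ne_zero R (mem_support_iff.1 h)
  · rintro ⟨σ, rfl⟩
    rw [mem_support_iff, coeff_permMonomial_perPoly]
    exact one_ne_zero

/-- The monomial set of the permanent as an image. [cite: JerrumSnir1982, §4.3 (p. 887)] -/
theorem support_perPoly (R : Type*) [CommSemiring R] [Nontrivial R] :
    (perPoly (Fin n) R).support = Finset.univ.image permMonomial := by
  ext m
  simp [mem_support_perPoly R, eq_comm]

/-- `|mon(per_n)| = n!`. [cite: JerrumSnir1982, §4.3 (p. 889, `n!/(n-1)!·(2^{n-1}-1)`)] -/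
theorem card_support_perPoly (R : Type*) [CommSemiring R] [Nontrivial R] :
    (perPoly (Fin n) R).support.card = n.factorial := by
  rw [support_perPoly R, Finset.card_image_of_injective _ permMonomial_injective,
    Finset.card_univ, Fintype.card_perm, Fintype.card_fin]

/-! ### The partition argument (JS p. 887–888) -/

/-- **One block of JS's partition argument.** If `a + e` is a permanent monomial for every
`a ∈ A`, and `a₀ ∈ A`, then `|A| ≤ (deg a₀)!` and `deg a₀ + deg e = n`: the columns (and rows)
not met by `e` are the same `deg a₀` columns for every `a ∈ A`, each `a ∈ A` is a perfect
matching on them, and `a ↦ σ_a` with `a + e = permMonomial σ_a` injects `A` into the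
permutations agreeing with `σ_{a₀}` on the columns of `e`. [cite: JerrumSnir1982, §4.3 (p. 887–888)] -/
theorem card_le_factorial_of_add_mem {A : Finset (Fin n × Fin n →₀ ℕ)}
    {e a₀ : Fin n × Fin n →₀ ℕ} (hA : ∀ a ∈ A, ∃ σ : Perm (Fin n), a + e = permMonomial σ)
    (ha₀ : a₀ ∈ A) : A.card ≤ (a₀.degree).factorial ∧ a₀.degree + e.degree = n := by
  classical
  obtain ⟨σ₀, hσ₀⟩ := hA a₀ ha₀
  -- the columns not met by `e`
  let p : Fin n → Prop := fun i => ∀ a, e (a, i) = 0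
  -- column counts of `x + e` are `1`
  have hcol : ∀ (x : Fin n × Fin n →₀ ℕ) (σ : Perm (Fin n)), x + e = permMonomial σ →
      ∀ i, colCount x i + colCount e i = 1 := by
    intro x σ hx i
    rw [← colCount_add, hx]
    exact colCount_permMonomial σ i
  have he_col : ∀ i, colCount e i = if p i then 0 else 1 := by
    intro i
    have h := hcol a₀ σ₀ hσ₀ i
    by_cases hp : p i
    · rw [if_pos hp]
      exact Finset.sum_eq_zero fun a _ => hp a
    · rw [if_neg hp]
      have hne : colCount e i ≠ 0 := by
        intro h0
        apply hp
        intro a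
        exact (Finset.sum_eq_zero_iff.1 h0) a (Finset.mem_univ a)
      omega
  have ha₀_col : ∀ i, colCount a₀ i = if p i then 1 else 0 := by
    intro i
    have h := hcol a₀ σ₀ hσ₀ i
    rw [he_col i] at h
    split_ifs at h ⊢ <;> omega
  -- degrees
  have hdeg_a₀ : a₀.degree = (Finset.univ.filter p).card := by
    rw [degree_eq_sum_colCount]
    simp_rw [ha₀_col]
    rw [Finset.sum_boole]
    simp
  have hdeg_e : e.degree = (Finset.univ.filter fun i => ¬ p i).card := by
    rw [degree_eq_sum_colCount, Finset.card_eq_sum_ones, Finset.sum_filter]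
    refine Finset.sum_congr rfl fun i _ => ?_
    rw [he_col i]
    by_cases hp : p i <;> simp [hp]
  have hsum : a₀.degree + e.degree = n := by
    rw [hdeg_a₀, hdeg_e, Finset.card_filter_add_card_filter_not, Finset.card_univ,
      Fintype.card_fin]
  refine ⟨?_, hsum⟩
  -- on the columns met by `e` every `σ` with `a + e = permMonomial σ` agrees with `σ₀`
  have key : ∀ (a : Fin n × Fin n →₀ ℕ) (σ : Perm (Fin n)), a + e = permMonomial σ →
      ∀ i, ¬ p i → σ i = σ₀ i := by
    intro a σ hσ i hpi
    simp only [p, not_forall] at hpi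
    obtain ⟨r, hr⟩ := hpi
    have h1 : permMonomial σ (r, i) ≠ 0 := by
      rw [← hσ, Finsupp.add_apply]; omega
    have h2 : permMonomial σ₀ (r, i) ≠ 0 := by
      rw [← hσ₀, Finsupp.add_apply]; omega
    rw [permMonomial_apply] at h1 h2
    simp only [ne_eq, ite_eq_right_iff, one_ne_zero, imp_false, not_not] at h1 h2
    rw [h1, h2]
  choose! σf hσf using hA
  let F : (Fin n × Fin n →₀ ℕ) → {τ : Perm (Fin n) // ∀ i, ¬ p i → τ i = i} := fun a =>
    if ha : a ∈ A then
      ⟨σ₀⁻¹ * σf a, fun i hi => by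
        rw [Perm.mul_apply, key a (σf a) (hσf a ha) i hi]
        exact σ₀.symm_apply_apply i⟩
    else ⟨1, fun _ _ => rfl⟩
  have hinj : Set.InjOn F A := by
    intro a ha b hb hab
    have ha' : a ∈ A := ha
    have hb' : b ∈ A := hb
    simp only [F, dif_pos ha', dif_pos hb', Subtype.mk.injEq, mul_right_inj] at hab
    have h : a + e = b + e := by rw [hσf a ha', hσf b hb', hab]
    exact add_right_cancel h
  calc A.card = (A.image F).card := (Finset.card_image_of_injOn hinj).symm
    _ ≤ Fintype.card {τ : Perm (Fin n) // ∀ i, ¬ p i → τ i = i} := Finset.card_le_univ _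
    _ = Fintype.card (Perm {i // p i}) :=
        Fintype.card_congr (Equiv.Perm.subtypeEquivSubtypePerm p).symm
    _ = (Fintype.card {i // p i}).factorial := Fintype.card_perm
    _ = (a₀.degree).factorial := by rw [Fintype.card_subtype, hdeg_a₀]

/-- **JS's content bound for the permanent (three-set form).** If `A + B + C ⊆ mon(per_n)` for
monomial sets with `a ∈ A`, `b ∈ B`, `C ≠ ∅`, then `|A| · |B| · |C| ≤ (deg a)! (deg b)! (n -
deg (a + b))!` and `deg (a + b) ≤ n`: the rows (and columns) split into the three blocks
occupied by `A`, `B`, `C`, of sizes `deg a`, `deg b`, `n - deg a - deg b`, and "elements of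
`mon(abc)` correspond to permutations `π` which observe the restrictions `π(I_a) = J_a`,
`π(I_b) = J_b`, `π(I_c) = J_c`. The total number of such permutations is clearly
`d! (r-d)! (n-r)!`". [cite: JerrumSnir1982, §4.3 (p. 887–888)] -/
theorem card_mul_card_mul_card_le (R : Type*) [CommSemiring R] [Nontrivial R]
    {A B C : Finset (Fin n × Fin n →₀ ℕ)} {a b : Fin n × Fin n →₀ ℕ} (ha : a ∈ A) (hb : b ∈ B)
    (hC : C.Nonempty)
    (h : ∀ a' ∈ A, ∀ b' ∈ B, ∀ c' ∈ C, a' + b' + c' ∈ (perPoly (Fin n) R).support) :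
    A.card * B.card * C.card ≤
        (a.degree).factorial * (b.degree).factorial * (n - (a + b).degree).factorial ∧
      (a + b).degree ≤ n := by
  obtain ⟨c, hc⟩ := hC
  have hA : ∀ a' ∈ A, ∃ σ : Perm (Fin n), a' + (b + c) = permMonomial σ := by
    intro a' ha'
    obtain ⟨σ, hσ⟩ := (mem_support_perPoly R).1 (h a' ha' b hb c hc)
    exact ⟨σ, by rw [← add_assoc, hσ]⟩
  have hB : ∀ b' ∈ B, ∃ σ : Perm (Fin n), b' + (a + c) = permMonomial σ := by
    intro b' hb'
    obtain ⟨σ, hσ⟩ := (mem_support_perPoly R).1 (h a ha b' hb' c hc)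
    exact ⟨σ, by rw [hσ]; abel⟩
  have hC' : ∀ c' ∈ C, ∃ σ : Perm (Fin n), c' + (a + b) = permMonomial σ := by
    intro c' hc'
    obtain ⟨σ, hσ⟩ := (mem_support_perPoly R).1 (h a ha b hb c' hc')
    exact ⟨σ, by rw [hσ]; abel⟩
  obtain ⟨hAcard, -⟩ := card_le_factorial_of_add_mem hA ha
  obtain ⟨hBcard, -⟩ := card_le_factorial_of_add_mem hB hb
  obtain ⟨hCcard, hCdeg⟩ := card_le_factorial_of_add_mem hC' hc
  have hcdeg : c.degree = n - (a + b).degree := by omega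
  refine ⟨?_, by omega⟩
  rw [← hcdeg]
  exact Nat.mul_le_mul (Nat.mul_le_mul hAcard hBcard) hCcard

/-! ### The lower bound for the permanent (JS Cor. 3.5 + §4.3) -/

section LowerBound

open scoped NNReal

/-- **The permanent satisfies the content bound hypothesis with `δ(r, d) = d! (r-d)! (n-r)!`.**
[cite: JerrumSnir1982, §4.3 (p. 888)] -/
theorem contentBound_perPoly (n : ℕ) : ContentBound (perPoly (Fin n) ℝ≥0) (perDelta n) := by
  intro A B C a ha b hb hC h
  obtain ⟨hle, -⟩ := card_mul_card_mul_card_le ℝ≥0 ha hb hC h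
  unfold perDelta
  have hsub : (a + b).degree - a.degree = b.degree := by
    rw [map_add]
    exact Nat.add_sub_cancel_left _ _
  rw [hsub]
  exact_mod_cast hle

/-- **The permanent's `δ` and `w` satisfy the weight recurrence hypothesis up to degree `n`**
(JS (3.3)–(3.5), Lemma 3.6, §4.3). [cite: JerrumSnir1982, Thm. 3.4, Lemma 3.6 and §4.3] -/
theorem weightBound_per (n : ℕ) : WeightBound n (perDelta n) (perWeight n) where
  zero := (perWeight_zero n).le
  one := (perWeight_one n).le
  pos := fun r d _ _ _ => perDelta_pos n r d
  recur := fun _ _ hd hdr hrn => perWeight_rec hd hdr hrn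

/-- The total weight of the monomials of the permanent is `n! · w(n)`.
[cite: JerrumSnir1982, Cor. 3.5 and §4.3 (p. 889)] -/
theorem sum_perWeight_support_perPoly (n : ℕ) :
    ∑ m ∈ (perPoly (Fin n) ℝ≥0).support, perWeight n m.degree = (n.factorial : ℝ) * perWeight n n := by
  have h : ∀ m ∈ (perPoly (Fin n) ℝ≥0).support, perWeight n m.degree = perWeight n n := by
    intro m hm
    obtain ⟨σ, rfl⟩ := (mem_support_perPoly ℝ≥0).1 hm
    rw [degree_permMonomial]
  rw [Finset.sum_congr rfl h, Finset.sum_const, card_support_perPoly, nsmul_eq_mul]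

/-- **Jerrum–Snir 1982, §4.3 — the lower bound: the monotone `⊗`-complexity of the `n × n`
permanent is at least `n (2^{n-1} - 1)`.** Every monotone computation (plain fan-in-two circuit
over `ℝ≥0`, `IsMonotoneComputation`) of `per_n`, `n ≥ 1`, has at least `n (2^{n-1} - 1)` product
gates: by Cor. 3.5 with the content bound `δ(r,d) = d!(r-d)!(n-r)!` and `w(n) = (2^{n-1}-1)/(n-1)!`,
"`⊗`-complexity of `p ≥ n!/(n-1)! · (2^{n-1} - 1) = n (2^{n-1} - 1)`".
[cite: JerrumSnir1982, §4.3 (p. 887–889) and Cor. 3.5] -/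
theorem le_prodCount_perPoly {n : ℕ} (hn : 1 ≤ n) {P : ArithCircuit ℝ≥0 (Fin n × Fin n)}
    (hP : IsMonotoneComputation P (perPoly (Fin n) ℝ≥0)) : n * (2 ^ (n - 1) - 1) ≤ prodCount P := by
  have hp0 : ∀ m ∈ (perPoly (Fin n) ℝ≥0).support, m ≠ 0 := by
    intro m hm
    obtain ⟨σ, rfl⟩ := (mem_support_perPoly ℝ≥0).1 hm
    exact permMonomial_ne_zero hn σ
  have hlin : ∀ m ∈ (perPoly (Fin n) ℝ≥0).support, ∀ i, m i ≤ 1 := by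
    intro m hm i
    obtain ⟨σ, rfl⟩ := (mem_support_perPoly ℝ≥0).1 hm
    exact permMonomial_apply_le_one σ i
  have hN : ∀ m ∈ (perPoly (Fin n) ℝ≥0).support, m.degree ≤ n := by
    intro m hm
    obtain ⟨σ, rfl⟩ := (mem_support_perPoly ℝ≥0).1 hm
    exact (degree_permMonomial σ).le
  have h := sum_weight_le_prodCount hP hp0 hlin hN (contentBound_perPoly n) (weightBound_per n)
  rw [sum_perWeight_support_perPoly, factorial_mul_perWeight_eq_natCast hn] at h
  exact_mod_cast h

end LowerBound

end JerrumSnir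

end Literature.Barriers.ValiantsHypothesis
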